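import Summits.ResolutionOfSingularities.ResolutionOfSingularities.Theorems.EquisingularLiftEquisingularLiftNatNDInvariants
import Literature.AlgebraicGeometry.Motives.ProjectiveSpaceCells
import Literature.AlgebraicGeometry.Resolution.SNCStrataSmooth
import Literature.AlgebraicGeometry.Resolution.StalkIdealLemmas
import HarnessLib

/-!
# Crux EL♮(3) `EquisingularLiftNatThree` (stmt-ResolutionOfSingularities-20148), chain W4.5b — DEAL «ND-K5» brick (B4γ) `ndInv_init`,
# part 1: THE CHART OF `ℙⁿ_k` AT A CLOSED POINT — `𝒪_{ℙⁿ,x}` as the localisation of `k[t₁,…,tₙ]` at a rational point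

[OURS · L1 W4.5b · EL♮(3) stmt-ResolutionOfSingularities-20148 · (B4γ) part 1 (γ3 of the feasibility memo) · res-type-027 g19 · helper,
`--supports`; def-free; nothing of the manuscript under review [Hironaka2017] is asserted; AI-written, weaker than expert review]

For the standard chart `chartι k n i : Spec k[t] ⟶ ℙⁿ_k` (`Motives/ProjectiveSpaceCells`, image `D₊(xᵢ)`):
* `mem_asHomogeneousIdeal_chartι_iff` — for `G` homogeneous of positive degree and ANY point `y` of the chart,
  `G ∈ 𝔭_{chartι y}` iff `dehomogenize i G ∈ 𝔭_y` (Mathlib `Proj.awayι_preimage_basicOpen` through `chartAlgEquiv`);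
* `exists_chartι_apply_eq` — over `k = k̄`, every closed point of `ℙⁿ_k` is `chartι k n i 𝔪_b` for some chart `i` and some
  `b ∈ kⁿ` (the charts cover; Nullstellensatz `MvPolynomial.isMaximal_iff_eq_vanishingIdeal_singleton`);
* `exists_chartRingHom` — at `x = chartι k n i y₀`, `𝔭_{y₀} = 𝔪_b`: a ring map `χ : k[t] → 𝒪_{ℙⁿ,x}` (germ ∘ chart) making `𝒪_{ℙⁿ,x}`
  the localisation of `k[t]` at `𝔪_b`, agreeing with `ND.baseToStalk` on constants, with `stalkIdeal I x = χ(J_I)·𝒪` for every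
  ideal sheaf `I` (`J_I` the ideal of `I` on the chart) and `chartι y ∈ supp I ↔ J_I ≤ 𝔭_y`; `𝒪_{ℙⁿ,x}` is regular of dimension `n`.

References: R. Hartshorne, *Algebraic Geometry* (1977), II Prop. 2.5, I Thm. 3.4 [Hartshorne1977].
-/

set_option linter.dupNamespace false -- mandated namespace `Summit.<Summit>.<Problem>` of this single-conjunct summit

noncomputable section

open CategoryTheory AlgebraicGeometry TopologicalSpace IsLocalRing MvPolynomial
open Literature.AlgebraicGeometry.Resolution
open Literature.AlgebraicGeometry.Motives

namespace Summit.ResolutionOfSingularities.ResolutionOfSingularities.Cruxes.EquisingularLiftNat.Sections.ND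

attribute [local instance] MvPolynomial.gradedAlgebra ProjBaseChange.algebraBase

variable (k : Type) [Field k] (n : ℕ)

/-! ## §1 Homogeneous equations through the chart -/

/-- **`G ∈ 𝔭_{chartι y} ↔ G(xᵢ := 1) ∈ 𝔭_y`** for `G` homogeneous of positive degree and any point `y` of the `i`-th chart.
[cite: Hartshorne1977, II Prop. 2.5] -/
theorem mem_asHomogeneousIdeal_chartι_iff (i : Fin (n + 1)) {m : ℕ} (hm : 0 < m) {G : MvPolynomial (Fin (n + 1)) k}
    (hG : G ∈ (MvPolynomial.homogeneousSubmodule (Fin (n + 1)) k) m) (y : Spec (CommRingCat.of (MvPolynomial (Fin n) k))) :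
    G ∈ ((ProjectiveSpaceCells.chartι k n i y : Proj (MvPolynomial.homogeneousSubmodule (Fin (n + 1)) k)) : ProjectiveSpectrum (MvPolynomial.homogeneousSubmodule (Fin (n + 1)) k)).asHomogeneousIdeal ↔
      ProjectiveSpace.dehomogenize k i G ∈ y.asIdeal := by
  have hpre : (ProjectiveSpaceCells.chartι k n i).base ⁻¹' ProjectiveSpectrum.zeroLocus (MvPolynomial.homogeneousSubmodule (Fin (n + 1)) k) {G} =
      PrimeSpectrum.zeroLocus {ProjectiveSpace.dehomogenize k i G ^ 1} := by
    rw [ProjectiveSpaceCells.chartι, Scheme.Hom.comp_base, TopCat.coe_comp, Set.preimage_comp,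
      ProjSubscheme.awayι_preimage_zeroLocus (MvPolynomial.homogeneousSubmodule (Fin (n + 1)) k) (ProjectiveSpace.X_mem i) zero_lt_one hG hm]
    change PrimeSpectrum.comap (ProjectiveSpace.chartAlgEquiv k i).toRingEquiv.toRingHom ⁻¹' _ = _
    rw [PrimeSpectrum.preimage_comap_zeroLocus, Set.image_singleton]
    refine congrArg _ (congrArg _ ?_)
    change ProjectiveSpace.ofChartRingHom k i (HomogeneousLocalization.Away.mk (MvPolynomial.homogeneousSubmodule (Fin (n + 1)) k) (ProjectiveSpace.X_mem i) m (G ^ 1) _) = _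
    rw [ProjectiveSpace.ofChartRingHom_mk, map_pow]
  have h := Set.ext_iff.mp hpre y
  simp only [Set.mem_preimage, pow_one] at h
  change {G} ⊆ (((ProjectiveSpaceCells.chartι k n i y : Proj (MvPolynomial.homogeneousSubmodule (Fin (n + 1)) k)) : ProjectiveSpectrum (MvPolynomial.homogeneousSubmodule (Fin (n + 1)) k)).asHomogeneousIdeal : Set _) ↔
    {ProjectiveSpace.dehomogenize k i G} ⊆ (y.asIdeal : Set _) at h
  simpa only [Set.singleton_subset_iff, SetLike.mem_coe] using h

/-! ## §2 Closed points lie in a chart at a rational point -/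

/-- **Every closed point of `ℙⁿ_k`, `k` algebraically closed, is `chartι k n i 𝔪_b`** for some chart `i` and `b ∈ kⁿ`.
[cite: Hartshorne1977, II Prop. 2.5] -/
theorem exists_chartι_apply_eq [IsAlgClosed k] (x : Proj (MvPolynomial.homogeneousSubmodule (Fin (n + 1)) k)) (hx : IsClosed ({x} : Set (Proj (MvPolynomial.homogeneousSubmodule (Fin (n + 1)) k)))) :
    ∃ (i : Fin (n + 1)) (b : Fin n → k) (y₀ : Spec (CommRingCat.of (MvPolynomial (Fin n) k))),
      y₀.asIdeal = MvPolynomial.vanishingIdeal k {b} ∧ ProjectiveSpaceCells.chartι k n i y₀ = x := by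
  -- a chart through `x`
  obtain ⟨i, y, hy⟩ := (ProjectiveSpace.chartCover n k).exists_eq x
  have hxi : x ∈ Proj.basicOpen (MvPolynomial.homogeneousSubmodule (Fin (n + 1)) k) (X i) := by
    rw [← ProjectiveSpace.opensRange_chartCover_f n k i]
    exact ⟨y, hy⟩
  have hxD : x ∈ Set.range (ProjectiveSpaceCells.chartι k n i).base := by
    rw [ProjectiveSpaceCells.range_chartι]
    exact hxi
  obtain ⟨y₀, hy₀⟩ := hxD
  -- `y₀` is closed, hence a rational point by the Nullstellensatz
  have hy₀cl : IsClosed ({y₀} : Set (Spec (CommRingCat.of (MvPolynomial (Fin n) k)))) := by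
    have hinj := (ProjectiveSpaceCells.chartι k n i).isOpenEmbedding.injective
    have : ({y₀} : Set _) = (ProjectiveSpaceCells.chartι k n i).base ⁻¹' {x} := by
      ext y'
      simp only [Set.mem_singleton_iff, Set.mem_preimage]
      constructor
      · rintro rfl; exact hy₀
      · intro h; exact hinj (h.trans hy₀.symm)
    rw [this]
    exact hx.preimage (ProjectiveSpaceCells.chartι k n i).continuous
  have hmax : y₀.asIdeal.IsMaximal := (PrimeSpectrum.isClosed_singleton_iff_isMaximal y₀).mp hy₀cl
  obtain ⟨b, hb⟩ := (MvPolynomial.isMaximal_iff_eq_vanishingIdeal_singleton (I := y₀.asIdeal)).mp hmax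
  exact ⟨i, b, y₀, hb, hy₀⟩

end Summit.ResolutionOfSingularities.ResolutionOfSingularities.Cruxes.EquisingularLiftNat.Sections.ND

end
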